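import Literature.MathematicalPhysics.StatisticalMechanics.TorusFRDFinalMultipliers
import HarnessLib

/-!
# The torus finite-range decomposition: the kernels and their real-space bounds

Topic `Literature/MathematicalPhysics/StatisticalMechanics`.  With the final multipliers `f_k(A,κ)` of
`TorusFRDFinalMultipliers.lean` we define the kernels of Buchholz's Thm 2.4 (scalar case),

  `𝒞_{A,k}(x) = M^{-d} Σ_{κ≠0} f_k(A,κ) χ_κ(x)`   (`frdKernel = mulKernel (fMultZ …)`),

and prove the analytic facts about them needed for Thm 2.4 (iv) and the regularity clause of (v):
evenness of the multipliers (`fMultZ_neg`), analyticity in the direction `s ↦ A + sȦ` on `|s| < ω₀`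
(`contDiffOn_fMultZ`, `contDiffOn_frdKernel`), the interchange of `∂_s^ℓ` with the finite Fourier sum,
the base REAL-SPACE estimate (Buchholz (2.28)/(A.12)–(A.16))

  `M^{-d} Σ_{κ≠0} |p|^{|α|} |∂_s^ℓ ĉ_j(κ)| ≤ C L^{-(j-1)(d-2+|α|)}`   (`exists_baseRealSpace_le`, `d ≥ 3`),

its propagation through the scale mixing (Buchholz (3.8), `mix_le_of_le_pow`), and the resulting bound

  `|∇^α ∂_s^ℓ 𝒞_{A+sȦ,k}(x)|_{s=0}| ≤ C(α,ℓ) L^{-(k-1)(d-2+|α|)}`, `|α| ≤ n`   (`exists_frdKernel_realSpace_le`).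

Everything is proved; no named facts.

## References
* S. Buchholz, *Finite range decomposition for Gaussian measures with improved regularity*,
  J. Funct. Anal. 275 (2018), Thm 2.3 (2.28), Prop 3.1 (3.8)–(3.9), Thm 2.4 (iv), App. A [Buchholz2016].
-/

noncomputable section

namespace Literature.MathematicalPhysics.StatisticalMechanics.GradientFRD

open Finset Literature.Analysis.Fourier Literature.Probability.LatticeModels
open scoped Real BigOperators

variable {d M : ℕ} [NeZero M]

/-! ## The multipliers extended by `0` at `κ = 0`, evenness -/

/-- The final multiplier extended by `0` at the zero mode (zero average). [cite: Buchholz2016, Thm 2.4 (𝒞_{A,k})] -/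
def fMultZ (Ω₀ : ℝ) (n ñ : ℕ) (K : ℝ) (L N k : ℕ) (A : Matrix (Fin d) (Fin d) ℝ) : (Fin d → ZMod M) → ℝ :=
  fun κ => if κ = 0 then 0 else finalMult Ω₀ n ñ K L N k A κ

/-- The kernel `𝒞_{A,k} = mulKernel f_k`. [cite: Buchholz2016, Thm 2.4 (𝒞_{A,k})] -/
def frdKernel (Ω₀ : ℝ) (n ñ : ℕ) (K : ℝ) (L N k : ℕ) (A : Matrix (Fin d) (Fin d) ℝ) : (Fin d → ZMod M) → ℝ :=
  mulKernel (fMultZ Ω₀ n ñ K L N k A)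

/-- The base multipliers are even in `κ`. [cite: Buchholz2016, Thm 2.4 (M_k(x) = M_k(−x))] -/
theorem baseMult_neg (Ω₀ : ℝ) (L N k : ℕ) (A : Matrix (Fin d) (Fin d) ℝ) (κ : Fin d → ZMod M) :
    baseMult Ω₀ L N k A (-κ) = baseMult Ω₀ L N k A κ := by
  unfold baseMult; rw [symbR_neg]

/-- The mixed multipliers are even in `κ`. [cite: Buchholz2016, Thm 2.4 (M_k(x) = M_k(−x))] -/
theorem mixMult_neg (Ω₀ : ℝ) (ν L N k : ℕ) (A : Matrix (Fin d) (Fin d) ℝ) (κ : Fin d → ZMod M) :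
    mixMult Ω₀ ν L N k A (-κ) = mixMult Ω₀ ν L N k A κ := by
  unfold mixMult; simp_rw [baseMult_neg]

/-- The final multipliers are even in `κ`. [cite: Buchholz2016, Thm 2.4 (M_k(x) = M_k(−x))] -/
theorem finalMult_neg (Ω₀ : ℝ) (n ñ : ℕ) (K : ℝ) (L N k : ℕ) (A : Matrix (Fin d) (Fin d) ℝ) (κ : Fin d → ZMod M) :
    finalMult Ω₀ n ñ K L N k A (-κ) = finalMult Ω₀ n ñ K L N k A κ := by
  unfold finalMult; simp_rw [mixMult_neg]

/-- `fMultZ` is even. [cite: Buchholz2016, Thm 2.4 (M_k(x) = M_k(−x))] -/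
theorem fMultZ_neg (Ω₀ : ℝ) (n ñ : ℕ) (K : ℝ) (L N k : ℕ) (A : Matrix (Fin d) (Fin d) ℝ) :
    ∀ κ : Fin d → ZMod M, fMultZ Ω₀ n ñ K L N k A (-κ) = fMultZ Ω₀ n ñ K L N k A κ := by
  intro κ
  by_cases hκ : κ = 0
  · simp [fMultZ, hκ]
  · simp [fMultZ, hκ, finalMult_neg]

/-- `fMultZ` vanishes at the zero mode. [cite: Buchholz2016, §1 (1.5)] -/
theorem fMultZ_zero (Ω₀ : ℝ) (n ñ : ℕ) (K : ℝ) (L N k : ℕ) (A : Matrix (Fin d) (Fin d) ℝ) :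
    fMultZ Ω₀ n ñ K L N k A (0 : Fin d → ZMod M) = 0 := by
  unfold fMultZ; rw [if_pos rfl]

/-- `fMultZ = finalMult` off the zero mode. [cite: Buchholz2016, Thm 2.4] -/
theorem fMultZ_of_ne (Ω₀ : ℝ) (n ñ : ℕ) (K : ℝ) (L N k : ℕ) (A : Matrix (Fin d) (Fin d) ℝ) {κ : Fin d → ZMod M}
    (hκ : κ ≠ 0) : fMultZ Ω₀ n ñ K L N k A κ = finalMult Ω₀ n ñ K L N k A κ := by
  unfold fMultZ; rw [if_neg hκ]

/-! ## Analyticity in the direction -/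

/-- `s ↦ 𝒟̂^ν_k(A + sȦ, κ)` is analytic on `|s| < ω₀`. [cite: Buchholz2016, Thm 2.4 ("real analytic")] -/
theorem contDiffOn_mixMult {ω₀ Ω₀ : ℝ} (hω : 0 < ω₀) {A : Matrix (Fin d) (Fin d) ℝ} (hA : IsElliptic ω₀ Ω₀ A)
    {B' : Matrix (Fin d) (Fin d) ℝ} (hB' : IsUnitSymm B') (ν L N k : ℕ) (κ : Fin d → ZMod M) {m : WithTop ℕ∞} :
    ContDiffOn ℝ m (fun s : ℝ => mixMult Ω₀ ν L N k (A + s • B') κ) (Set.Ioo (-ω₀) ω₀) := by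
  unfold mixMult mix
  exact ContDiffOn.sum fun j _ => contDiffOn_const.mul (contDiffOn_baseMult hω hA hB' L N j κ)

/-- `s ↦ f_k(A + sȦ, κ)` is analytic on `|s| < ω₀`. [cite: Buchholz2016, Thm 2.4 ("real analytic")] -/
theorem contDiffOn_finalMult {ω₀ Ω₀ : ℝ} (hω : 0 < ω₀) {A : Matrix (Fin d) (Fin d) ℝ} (hA : IsElliptic ω₀ Ω₀ A)
    {B' : Matrix (Fin d) (Fin d) ℝ} (hB' : IsUnitSymm B') (n ñ : ℕ) (K : ℝ) (L N k : ℕ) (κ : Fin d → ZMod M)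
    {m : WithTop ℕ∞} :
    ContDiffOn ℝ m (fun s : ℝ => finalMult Ω₀ n ñ K L N k (A + s • B') κ) (Set.Ioo (-ω₀) ω₀) := by
  unfold finalMult
  exact ((contDiffOn_mixMult hω hA hB' ñ L N k κ).sub (contDiffOn_const.mul contDiffOn_const)).add
    (contDiffOn_const.mul contDiffOn_const)

/-- `s ↦ fMultZ(A + sȦ)(κ)` is analytic on `|s| < ω₀`. [cite: Buchholz2016, Thm 2.4 ("real analytic")] -/
theorem contDiffOn_fMultZ {ω₀ Ω₀ : ℝ} (hω : 0 < ω₀) {A : Matrix (Fin d) (Fin d) ℝ} (hA : IsElliptic ω₀ Ω₀ A)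
    {B' : Matrix (Fin d) (Fin d) ℝ} (hB' : IsUnitSymm B') (n ñ : ℕ) (K : ℝ) (L N k : ℕ) (κ : Fin d → ZMod M)
    {m : WithTop ℕ∞} :
    ContDiffOn ℝ m (fun s : ℝ => fMultZ Ω₀ n ñ K L N k (A + s • B') κ) (Set.Ioo (-ω₀) ω₀) := by
  rcases eq_or_ne κ 0 with hκ | hκ
  · simp only [fMultZ, hκ, if_true]; exact contDiffOn_const
  · simp only [fMultZ, hκ, if_false]; exact contDiffOn_finalMult hω hA hB' n ñ K L N k κ

/-- **Analyticity of the kernels in the direction**: `s ↦ 𝒞_{A+sȦ,k}(x)` is analytic on `|s| < ω₀`.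
[cite: Buchholz2016, Thm 2.4 ("The map is … real analytic")] -/
theorem contDiffOn_frdKernel {ω₀ Ω₀ : ℝ} (hω : 0 < ω₀) {A : Matrix (Fin d) (Fin d) ℝ} (hA : IsElliptic ω₀ Ω₀ A)
    {B' : Matrix (Fin d) (Fin d) ℝ} (hB' : IsUnitSymm B') (n ñ : ℕ) (K : ℝ) (L N k : ℕ) (x : Fin d → ZMod M)
    {m : WithTop ℕ∞} :
    ContDiffOn ℝ m (fun s : ℝ => frdKernel Ω₀ n ñ K L N k (A + s • B') x) (Set.Ioo (-ω₀) ω₀) := by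
  unfold frdKernel
  simp_rw [mulKernel_eq_sum]
  exact ContDiffOn.sum fun κ _ => (contDiffOn_fMultZ hω hA hB' n ñ K L N k κ).mul contDiffOn_const

/-! ## Interchanging `∂_s^ℓ` with the finite Fourier sum -/

/-- Iterated derivatives of finite linear combinations (pointwise smoothness). [folklore] -/
private theorem iteratedDeriv_finset_sum' {ι : Type*} (S : Finset ι) (w : ι → ℝ) (f : ι → ℝ → ℝ) (n : ℕ) (x : ℝ)
    (hf : ∀ i ∈ S, ContDiffAt ℝ n (f i) x) :
    iteratedDeriv n (fun s => ∑ i ∈ S, f i s * w i) x = ∑ i ∈ S, iteratedDeriv n (f i) x * w i := by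
  classical
  induction S using Finset.induction_on with
  | empty => simp
  | insert a S ha ih =>
    have hfS : ∀ i ∈ S, ContDiffAt ℝ n (f i) x := fun i hi => hf i (Finset.mem_insert_of_mem hi)
    have hfa : ContDiffAt ℝ n (f a) x := hf a (Finset.mem_insert_self a S)
    have hsum : ContDiffAt ℝ n (fun s => ∑ i ∈ S, f i s * w i) x :=
      ContDiffAt.sum fun i hi => (hfS i hi).mul contDiffAt_const
    simp only [Finset.sum_insert ha]
    have hadd : (fun s => f a s * w a + ∑ i ∈ S, f i s * w i) = (fun s => f a s * w a) + fun s => ∑ i ∈ S, f i s * w i := rfl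
    rw [hadd, iteratedDeriv_add (hfa.mul contDiffAt_const) hsum, ih hfS]
    congr 1
    have : (fun s => f a s * w a) = fun s => w a * f a s := by funext s; ring
    rw [this, iteratedDeriv_const_mul (w a) hfa]; ring

/-- **`∂_s^ℓ ∇^α 𝒞_{A+sȦ,k}(x) = Σ_κ ∂_s^ℓ f_k(A+sȦ,κ) · Re(M^{-d} q^α χ_κ(x))`**.
[cite: Buchholz2016, App. A (A.9)–(A.12)] -/
theorem iteratedDeriv_iterDiff_frdKernel {ω₀ Ω₀ : ℝ} (hω : 0 < ω₀) {A : Matrix (Fin d) (Fin d) ℝ}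
    (hA : IsElliptic ω₀ Ω₀ A) {B' : Matrix (Fin d) (Fin d) ℝ} (hB' : IsUnitSymm B') (n ñ : ℕ) (K : ℝ) (L N k : ℕ)
    (α : Fin d → ℕ) (x : Fin d → ZMod M) (ℓ : ℕ) :
    iteratedDeriv ℓ (fun s : ℝ => iterDiff α (frdKernel Ω₀ n ñ K L N k (A + s • B')) x) 0 =
      ∑ κ, iteratedDeriv ℓ (fun s : ℝ => fMultZ Ω₀ n ñ K L N k (A + s • B') κ) 0 *
        ((((M : ℂ) ^ d))⁻¹ * qpow α κ * torusChar κ x).re := by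
  unfold frdKernel
  simp_rw [iterDiff_mulKernel_eq_sum (fMultZ_neg _ _ _ _ _ _ _ _)]
  exact iteratedDeriv_finset_sum' _ _ (fun κ s => fMultZ Ω₀ n ñ K L N k (A + s • B') κ) ℓ 0 fun κ _ =>
    (contDiffOn_fMultZ hω hA hB' n ñ K L N k κ).contDiffAt (Ioo_mem_nhds (by linarith) hω)

/-! ## The base real-space estimate -/

/-- Two upper bounds combine into a `min`: `v ≤ a`, `v ≤ a y` ⇒ `v ≤ a min(1, y)` (`a ≥ 0`). [folklore] -/
private theorem le_mul_min_of_le {v a y : ℝ} (h1 : v ≤ a) (h2 : v ≤ a * y) : v ≤ a * min 1 y := by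
  rcases le_total 1 y with h | h
  · rw [min_eq_left h, mul_one]; exact h1
  · rw [min_eq_right h]; exact h2

/-- **Base real-space estimate (Buchholz (2.28) via (A.12)–(A.16))**: for `d ≥ 3`, every `ℓ`, `s` and `J`
with `d + s ≤ 2J + 1` there is `C` such that for all `L ≥ 5`, `N ≥ 1`, `M = L^N`, `A ∈ 𝓛`, `‖Ȧ‖ ≤ 1`,
`1 ≤ j ≤ N+1`: `M^{-d} Σ_{κ≠0} |p|^s |∂_s^ℓ ĉ_j(A+sȦ,κ)| ≤ C / L^{(j-1)(d-2+s)}`.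
[cite: Buchholz2016, Thm 2.3 (2.28), App. A (A.12)–(A.16)] -/
theorem exists_baseRealSpace_le (d : ℕ) (hd : 3 ≤ d) {ω₀ Ω₀ : ℝ} (hω : 0 < ω₀) (hωΩ : ω₀ < Ω₀) (ℓ s J : ℕ)
    (hJ : d + s ≤ 2 * J + 1) :
    ∃ C, 0 ≤ C ∧ ∀ (L N M : ℕ) [NeZero M], 5 ≤ L → 1 ≤ N → M = L ^ N →
      ∀ A : Matrix (Fin d) (Fin d) ℝ, IsElliptic ω₀ Ω₀ A → ∀ B' : Matrix (Fin d) (Fin d) ℝ, IsUnitSymm B' →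
        ∀ j, 1 ≤ j → j ≤ N + 1 →
          (((M : ℝ) ^ d))⁻¹ * ∑ κ ∈ (Finset.univ : Finset (Fin d → ZMod M)).erase 0,
              momNorm κ ^ s * |iteratedDeriv ℓ (fun t : ℝ => baseMult Ω₀ L N j (A + t • B') κ) 0| ≤
            C / (L : ℝ) ^ ((j - 1) * (d - 2 + s)) := by
  obtain ⟨U0, hU00, hU0⟩ := exists_baseMult_deriv_le_decay d (by omega) hω hωΩ ℓ 0
  obtain ⟨U2, hU20, hU2⟩ := exists_baseMult_deriv_le_decay d (by omega) hω hωΩ ℓ (2 * J)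
  obtain ⟨CL, hCL0, hCL⟩ := exists_latticeSum_le d s J hd hJ
  set U : ℝ := max U0 U2 with hU
  have hUnn : 0 ≤ U := le_max_of_le_left hU00
  refine ⟨U * CL, by positivity, fun L N M _ hL hN hM A hA B' hB' j hj1 hj => ?_⟩
  have hL1 : (1 : ℝ) ≤ L := by exact_mod_cast (show 1 ≤ L by omega)
  have hL0 : (0 : ℝ) < L := by linarith
  set R : ℝ := (L : ℝ) ^ (j - 1) with hR
  have hRpos : 0 < R := by positivity
  have hR1 : 1 ≤ R := one_le_pow₀ hL1
  -- pointwise: `|∂^ℓ ĉ_j(κ)| ≤ U |p|^{-2} min(1, (R|p|)^{-2J})`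
  have hpt : ∀ κ ∈ (Finset.univ : Finset (Fin d → ZMod M)).erase 0,
      momNorm κ ^ s * |iteratedDeriv ℓ (fun t : ℝ => baseMult Ω₀ L N j (A + t • B') κ) 0| ≤
        U * (momNorm κ ^ s * ((momNorm κ ^ 2)⁻¹ * min 1 ((R * momNorm κ)⁻¹ ^ (2 * J)))) := by
    intro κ hκ
    have hκ0 : κ ≠ 0 := Finset.ne_of_mem_erase hκ
    have hp := momNorm_pos hκ0
    have h0 := hU0 L N M hL hN A hA B' hB' j hj1 hj κ hκ0
    have h2 := hU2 L N M hL hN A hA B' hB' j hj1 hj κ hκ0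
    rw [pow_zero, mul_one] at h0
    have hv : |iteratedDeriv ℓ (fun t : ℝ => baseMult Ω₀ L N j (A + t • B') κ) 0| ≤
        U * (momNorm κ ^ 2)⁻¹ * min 1 ((R * momNorm κ)⁻¹ ^ (2 * J)) := by
      refine le_mul_min_of_le ?_ ?_
      · calc _ ≤ U0 / momNorm κ ^ 2 := h0
          _ ≤ U * (momNorm κ ^ 2)⁻¹ := by rw [div_eq_mul_inv]; gcongr; exact le_max_left _ _
      · calc _ ≤ U2 / (momNorm κ ^ 2 * (momNorm κ * (L : ℝ) ^ (j - 1)) ^ (2 * J)) := h2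
          _ = U2 * (momNorm κ ^ 2)⁻¹ * (R * momNorm κ)⁻¹ ^ (2 * J) := by
              rw [hR, mul_comm (momNorm κ) ((L : ℝ) ^ (j - 1)), inv_pow, div_eq_mul_inv, mul_inv, mul_assoc]
          _ ≤ U * (momNorm κ ^ 2)⁻¹ * (R * momNorm κ)⁻¹ ^ (2 * J) := by gcongr; exact le_max_right _ _
    calc momNorm κ ^ s * |iteratedDeriv ℓ (fun t : ℝ => baseMult Ω₀ L N j (A + t • B') κ) 0|
        ≤ momNorm κ ^ s * (U * (momNorm κ ^ 2)⁻¹ * min 1 ((R * momNorm κ)⁻¹ ^ (2 * J))) :=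
          mul_le_mul_of_nonneg_left hv (by positivity)
      _ = U * (momNorm κ ^ s * ((momNorm κ ^ 2)⁻¹ * min 1 ((R * momNorm κ)⁻¹ ^ (2 * J)))) := by ring
  have hsum := hCL M R hRpos
  calc (((M : ℝ) ^ d))⁻¹ * ∑ κ ∈ (Finset.univ : Finset (Fin d → ZMod M)).erase 0,
          momNorm κ ^ s * |iteratedDeriv ℓ (fun t : ℝ => baseMult Ω₀ L N j (A + t • B') κ) 0|
      ≤ (((M : ℝ) ^ d))⁻¹ * ∑ κ ∈ (Finset.univ : Finset (Fin d → ZMod M)).erase 0,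
          U * (momNorm κ ^ s * ((momNorm κ ^ 2)⁻¹ * min 1 ((R * momNorm κ)⁻¹ ^ (2 * J)))) :=
        mul_le_mul_of_nonneg_left (sum_le_sum hpt) (by positivity)
    _ = U * ((((M : ℝ) ^ d))⁻¹ * ∑ κ ∈ (Finset.univ : Finset (Fin d → ZMod M)).erase 0,
          momNorm κ ^ s * ((momNorm κ ^ 2)⁻¹ * min 1 ((R * momNorm κ)⁻¹ ^ (2 * J)))) := by
        rw [← Finset.mul_sum]; ring
    _ ≤ U * (CL * min 1 (R⁻¹ ^ (d - 2 + s))) := mul_le_mul_of_nonneg_left hsum hUnn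
    _ ≤ U * (CL * R⁻¹ ^ (d - 2 + s)) := by gcongr; exact min_le_right _ _
    _ = U * CL / (L : ℝ) ^ ((j - 1) * (d - 2 + s)) := by rw [hR, inv_pow, ← pow_mul, div_eq_mul_inv]; ring

/-! ## Propagation through the scale mixing (Buchholz (3.8)) -/

/-- **(3.8)**: if `0 ≤ c_j ≤ V L^{-(j-1)e}` for `j ≤ k` and `e + 1 ≤ γ`, then `mix c k ≤ 2V L^{-(k-1)e}`.
[cite: Buchholz2016, Prop 3.1 (3.8)] -/
theorem mix_le_of_le_pow {L : ℝ} (hL : 5 ≤ L) {γ e : ℕ} (hγ : e + 1 ≤ γ) (N : ℕ) {c : ℕ → ℝ} {V : ℝ} (hV : 0 ≤ V)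
    {k : ℕ} (hc : ∀ j, 1 ≤ j → j ≤ k → c j ≤ V / L ^ ((j - 1) * e)) :
    mix L γ N c k ≤ 2 * V / L ^ ((k - 1) * e) := by
  have hL0 : 0 < L := by linarith
  have hL1 : 1 ≤ L := by linarith
  have hγ1 : 1 ≤ γ := by omega
  unfold mix
  have hterm : ∀ j ∈ Finset.Icc 1 k, mixCoeff L γ N k j * c j ≤ V / L ^ ((k - 1) * e) * (L ^ (k - j))⁻¹ := by
    intro j hj
    rw [Finset.mem_Icc] at hj
    have h1 := mixCoeff_le_inv_pow hL hγ1 N hj.2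
    have h2 := hc j hj.1 hj.2
    have hl0 := mixCoeff_nonneg hL hγ1 N k j
    calc mixCoeff L γ N k j * c j ≤ mixCoeff L γ N k j * (V / L ^ ((j - 1) * e)) := mul_le_mul_of_nonneg_left h2 hl0
      _ ≤ (L ^ ((k - j) * γ))⁻¹ * (V / L ^ ((j - 1) * e)) := mul_le_mul_of_nonneg_right h1 (by positivity)
      _ ≤ (L ^ ((k - j) * (e + 1)))⁻¹ * (V / L ^ ((j - 1) * e)) := by
          refine mul_le_mul_of_nonneg_right ?_ (by positivity)
          exact inv_anti₀ (by positivity) (pow_le_pow_right₀ hL1 (Nat.mul_le_mul_left _ hγ))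
      _ = V / L ^ ((k - 1) * e) * (L ^ (k - j))⁻¹ := by
          -- `(k-j)(e+1) + (j-1)e = (k-1)e + (k-j)`
          have hexp : (k - j) * (e + 1) + (j - 1) * e = (k - 1) * e + (k - j) := by
            obtain ⟨a, rfl⟩ : ∃ a, j = 1 + a := ⟨j - 1, by omega⟩
            obtain ⟨b, rfl⟩ : ∃ b, k = 1 + a + b := ⟨k - (1 + a), by omega⟩
            simp only [Nat.add_sub_cancel_left, show 1 + a + b - (1 + a) = b by omega, show 1 + a + b - 1 = a + b by omega]
            ring
          rw [div_eq_mul_inv, div_eq_mul_inv]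
          have hL' : (L ^ ((k - j) * (e + 1)))⁻¹ * (L ^ ((j - 1) * e))⁻¹ = (L ^ ((k - 1) * e))⁻¹ * (L ^ (k - j))⁻¹ := by
            rw [← mul_inv, ← mul_inv, ← pow_add, ← pow_add, hexp]
          calc (L ^ ((k - j) * (e + 1)))⁻¹ * (V * (L ^ ((j - 1) * e))⁻¹)
              = V * ((L ^ ((k - j) * (e + 1)))⁻¹ * (L ^ ((j - 1) * e))⁻¹) := by ring
            _ = V * (L ^ ((k - 1) * e))⁻¹ * (L ^ (k - j))⁻¹ := by rw [hL']; ring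
  refine (sum_le_sum hterm).trans ?_
  rw [← Finset.mul_sum]
  have hgeom : ∑ j ∈ Finset.Icc 1 k, (L ^ (k - j))⁻¹ ≤ 2 := by
    rw [← Finset.Ico_add_one_right_eq_Icc, Finset.sum_Ico_eq_sum_range, show k + 1 - 1 = k by omega]
    have : ∑ i ∈ Finset.range k, (L ^ (k - (1 + i)))⁻¹ = ∑ i ∈ Finset.range k, (L⁻¹) ^ (k - 1 - i) :=
      sum_congr rfl fun i _ => by rw [inv_pow]; congr 2; omega
    rw [this, Finset.sum_range_reflect (fun i => (L⁻¹) ^ i) k]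
    refine geom_sum_le_two (by positivity) ?_ k
    rw [inv_le_comm₀ hL0 (by norm_num)]; linarith
  calc V / L ^ ((k - 1) * e) * ∑ j ∈ Finset.Icc 1 k, (L ^ (k - j))⁻¹ ≤ V / L ^ ((k - 1) * e) * 2 :=
        mul_le_mul_of_nonneg_left hgeom (by positivity)
    _ = 2 * V / L ^ ((k - 1) * e) := by ring

/-- `|mix c| ≤ mix |c|` (the coefficients are nonnegative). [cite: Buchholz2016, Prop 3.1 (3.9)] -/
theorem abs_mix_le_mix_abs {L : ℝ} (hL : 5 ≤ L) {γ : ℕ} (hγ : 1 ≤ γ) (N : ℕ) (c : ℕ → ℝ) (k : ℕ) :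
    |mix L γ N c k| ≤ mix L γ N (fun j => |c j|) k := by
  unfold mix
  refine (abs_sum_le_sum_abs _ _).trans (le_of_eq (sum_congr rfl fun j _ => ?_))
  rw [abs_mul, abs_of_nonneg (mixCoeff_nonneg hL hγ N k j)]

/-! ## The real-space bound for the kernels (Thm 2.4 (iv)) -/

omit [NeZero M] in
/-- Swapping the mode sum with the mixing sum. [cite: Buchholz2016, Prop 3.1 (3.9)] -/
theorem sum_mul_mix (L' : ℝ) (γ N k : ℕ) (S : Finset (Fin d → ZMod M)) (w : (Fin d → ZMod M) → ℝ)
    (c : (Fin d → ZMod M) → ℕ → ℝ) :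
    ∑ κ ∈ S, w κ * mix L' γ N (c κ) k = mix L' γ N (fun j => ∑ κ ∈ S, w κ * c κ j) k := by
  unfold mix
  calc ∑ κ ∈ S, w κ * ∑ j ∈ Finset.Icc 1 k, mixCoeff L' γ N k j * c κ j
      = ∑ κ ∈ S, ∑ j ∈ Finset.Icc 1 k, w κ * (mixCoeff L' γ N k j * c κ j) := by simp_rw [Finset.mul_sum]
    _ = ∑ j ∈ Finset.Icc 1 k, ∑ κ ∈ S, w κ * (mixCoeff L' γ N k j * c κ j) := Finset.sum_comm
    _ = ∑ j ∈ Finset.Icc 1 k, mixCoeff L' γ N k j * ∑ κ ∈ S, w κ * c κ j :=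
        sum_congr rfl fun j _ => by
          rw [Finset.mul_sum]
          exact sum_congr rfl fun κ _ => by ring

/-- **Real-space bound (Thm 2.4 (iv))**: for `d ≥ 3`, `n ≤ ñ` and every `ℓ, s` there is `C` such that
for all `L ≥ 5`, `N ≥ 1`, `M = L^N`, `A ∈ 𝓛`, `‖Ȧ‖ ≤ 1`, `K ≥ 1`, `1 ≤ k ≤ N+1`, every multi-index `α` with
`|α| = s ≤ n` and every `x`:
`|∂_s^ℓ ∇^α 𝒞_{A+sȦ,k}(x)|_{s=0}| ≤ C L^{-(k-1)(d-2+s)}`.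
[cite: Buchholz2016, Thm 2.4 (iv), Prop 3.1 (3.4), (3.8)–(3.9)] -/
theorem exists_frdKernel_realSpace_le (d : ℕ) (hd : 3 ≤ d) {ω₀ Ω₀ : ℝ} (hω : 0 < ω₀) (hωΩ : ω₀ < Ω₀) {n ñ : ℕ}
    (hnñ : n ≤ ñ) (ℓ s : ℕ) (hs : s ≤ n) :
    ∃ C, 0 ≤ C ∧ ∀ (L N M : ℕ) [NeZero M], 5 ≤ L → 1 ≤ N → M = L ^ N →
      ∀ A : Matrix (Fin d) (Fin d) ℝ, IsElliptic ω₀ Ω₀ A → ∀ B' : Matrix (Fin d) (Fin d) ℝ, IsUnitSymm B' →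
        ∀ K : ℝ, 1 ≤ K → ∀ k, 1 ≤ k → k ≤ N + 1 → ∀ α : Fin d → ℕ, ∑ i, α i = s → ∀ x : Fin d → ZMod M,
          |iteratedDeriv ℓ (fun t : ℝ => iterDiff α (frdKernel Ω₀ n ñ K L N k (A + t • B')) x) 0| ≤
            C / (L : ℝ) ^ ((k - 1) * (d - 2 + s)) := by
  have hJ : d + s ≤ 2 * (d + n) + 1 := by omega
  obtain ⟨Cℓ, hCℓ0, hCℓ⟩ := exists_baseRealSpace_le d hd hω hωΩ ℓ s (d + n) hJ
  obtain ⟨C0, hC00, hC0⟩ := exists_baseRealSpace_le d hd hω hωΩ 0 s (d + n) hJ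
  refine ⟨2 * Cℓ + 6 * C0, by positivity, fun L N M _ hL hN hM A hA B' hB' K hK k hk1 hk α hα x => ?_⟩
  have hL' : (5 : ℝ) ≤ (L : ℝ) := by exact_mod_cast hL
  have hL0 : (0 : ℝ) < L := by linarith
  have hd2 : 2 ≤ d := by omega
  have hΩ := hω.trans hωΩ
  have hA₀ : IsElliptic ω₀ Ω₀ (refOp d Ω₀) := refOp_isElliptic hωΩ.le
  have h0unit : IsUnitSymm (0 : Matrix (Fin d) (Fin d) ℝ) :=
    ⟨Matrix.isSymm_zero, fun z => by simp [sum_nonneg, sq_nonneg]⟩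
  have hθ := thetaC_pos_le (d := d) (ñ := ñ) hK (show 1 ≤ L by omega)
  rw [iteratedDeriv_iterDiff_frdKernel hω hA hB' n ñ K L N k α x ℓ]
  -- drop the zero mode and bound by `M^{-d} Σ_{κ≠0} |p|^s |∂^ℓ f_k(κ)|`
  set S : Finset (Fin d → ZMod M) := (Finset.univ : Finset (Fin d → ZMod M)).erase 0 with hS
  set u : (Fin d → ZMod M) → ℝ := fun κ => iteratedDeriv ℓ (fun t : ℝ => fMultZ Ω₀ n ñ K L N k (A + t • B') κ) 0 with hu
  have hu0 : u 0 = 0 := by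
    simp only [hu, fMultZ_zero]
    rw [iteratedDeriv_const]; split_ifs <;> rfl
  have hbound := abs_sum_mul_re_le u α x
  have hsplit : ∑ κ, |u κ| * momNorm κ ^ ∑ i, α i = ∑ κ ∈ S, |u κ| * momNorm κ ^ s := by
    rw [hα, ← Finset.add_sum_erase _ _ (Finset.mem_univ (0 : Fin d → ZMod M)), hu0, abs_zero, zero_mul, zero_add]
  rw [hsplit] at hbound
  refine hbound.trans ?_
  -- for `κ ≠ 0`, `u κ = ∂^ℓ f_k(A + tȦ, κ)`
  have huκ : ∀ κ ∈ S, u κ = iteratedDeriv ℓ (fun t : ℝ => finalMult Ω₀ n ñ K L N k (A + t • B') κ) 0 := by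
    intro κ hκ
    have hκ0 : κ ≠ 0 := Finset.ne_of_mem_erase hκ
    simp only [hu, fMultZ, hκ0, if_false]
  -- the base real-space quantities
  set RS : Matrix (Fin d) (Fin d) ℝ → Matrix (Fin d) (Fin d) ℝ → ℕ → ℕ → ℝ := fun A' B'' ℓ' j =>
    (((M : ℝ) ^ d))⁻¹ * ∑ κ ∈ S, momNorm κ ^ s * |iteratedDeriv ℓ' (fun t : ℝ => baseMult Ω₀ L N j (A' + t • B'') κ) 0|
    with hRS
  have hRSnn : ∀ A' B'' ℓ' j, 0 ≤ RS A' B'' ℓ' j := fun A' B'' ℓ' j => by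
    simp only [hRS]; exact mul_nonneg (by positivity) (sum_nonneg fun κ _ => by have := momNorm_nonneg κ; positivity)
  -- mixing of the base real-space bounds
  have hmixRS : ∀ (ν : ℕ), s ≤ ν → ∀ A' B'' ℓ' (C' : ℝ), 0 ≤ C' → IsElliptic ω₀ Ω₀ A' → IsUnitSymm B'' →
      (∀ j, 1 ≤ j → j ≤ N + 1 → RS A' B'' ℓ' j ≤ C' / (L : ℝ) ^ ((j - 1) * (d - 2 + s))) →
      mix (L : ℝ) (gammaExp d ν) N (RS A' B'' ℓ') k ≤ 2 * C' / (L : ℝ) ^ ((k - 1) * (d - 2 + s)) := by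
    intro ν hν A' B'' ℓ' C' hC' _ _ hj
    refine mix_le_of_le_pow hL' (γ := gammaExp d ν) (e := d - 2 + s) (by unfold gammaExp; omega) N hC' ?_
    intro j hj1 hjk
    exact hj j hj1 (by omega)
  -- Case split on `ℓ`
  rcases Nat.eq_zero_or_pos ℓ with hℓ0 | hℓpos
  · -- `ℓ = 0`: three terms
    subst hℓ0
    have hptwise : ∀ κ ∈ S, |u κ| * momNorm κ ^ s ≤
        momNorm κ ^ s * (mix (L : ℝ) (gammaExp d ñ) N (fun j => |iteratedDeriv 0 (fun t : ℝ => baseMult Ω₀ L N j (A + t • B') κ) 0|) k +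
          mix (L : ℝ) (gammaExp d ñ) N (fun j => |iteratedDeriv 0 (fun t : ℝ => baseMult Ω₀ L N j (refOp d Ω₀ + t • (0 : Matrix (Fin d) (Fin d) ℝ)) κ) 0|) k +
          mix (L : ℝ) (gammaExp d n) N (fun j => |iteratedDeriv 0 (fun t : ℝ => baseMult Ω₀ L N j (refOp d Ω₀ + t • (0 : Matrix (Fin d) (Fin d) ℝ)) κ) 0|) k) := by
      intro κ hκ
      rw [huκ κ hκ, mul_comm]
      refine mul_le_mul_of_nonneg_left ?_ (pow_nonneg (momNorm_nonneg κ) s)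
      simp only [iteratedDeriv_zero, zero_smul, add_zero]
      unfold finalMult
      have h1 := abs_mix_le_mix_abs hL' (one_le_gammaExp hd2 ñ) N (fun j => baseMult Ω₀ L N j A κ) k
      have h2 := abs_mix_le_mix_abs hL' (one_le_gammaExp hd2 ñ) N (fun j => baseMult Ω₀ L N j (refOp d Ω₀) κ) k
      have h3 := abs_mix_le_mix_abs hL' (one_le_gammaExp hd2 n) N (fun j => baseMult Ω₀ L N j (refOp d Ω₀) κ) k
      unfold mixMult
      calc |mix (L : ℝ) (gammaExp d ñ) N (fun j => baseMult Ω₀ L N j A κ) k -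
              thetaC d ñ K L * mix (L : ℝ) (gammaExp d ñ) N (fun j => baseMult Ω₀ L N j (refOp d Ω₀) κ) k +
              thetaC d ñ K L * mix (L : ℝ) (gammaExp d n) N (fun j => baseMult Ω₀ L N j (refOp d Ω₀) κ) k|
          ≤ |mix (L : ℝ) (gammaExp d ñ) N (fun j => baseMult Ω₀ L N j A κ) k| +
              thetaC d ñ K L * |mix (L : ℝ) (gammaExp d ñ) N (fun j => baseMult Ω₀ L N j (refOp d Ω₀) κ) k| +
              thetaC d ñ K L * |mix (L : ℝ) (gammaExp d n) N (fun j => baseMult Ω₀ L N j (refOp d Ω₀) κ) k| := by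
            refine (abs_add_le _ _).trans (add_le_add ((abs_sub _ _).trans (add_le_add le_rfl ?_)) ?_)
            · rw [abs_mul, abs_of_pos hθ.1]
            · rw [abs_mul, abs_of_pos hθ.1]
        _ ≤ |mix (L : ℝ) (gammaExp d ñ) N (fun j => baseMult Ω₀ L N j A κ) k| +
              1 * |mix (L : ℝ) (gammaExp d ñ) N (fun j => baseMult Ω₀ L N j (refOp d Ω₀) κ) k| +
              1 * |mix (L : ℝ) (gammaExp d n) N (fun j => baseMult Ω₀ L N j (refOp d Ω₀) κ) k| := by
            gcongr <;> exact hθ.2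
        _ ≤ _ := by rw [one_mul, one_mul]; exact add_le_add (add_le_add h1 h2) h3
    have hC1 := fun j hj1 hjN => hC0 L N M hL hN hM A hA B' hB' j hj1 hjN
    have hC2 := fun j hj1 hjN => hC0 L N M hL hN hM (refOp d Ω₀) hA₀ 0 h0unit j hj1 hjN
    calc (((M : ℝ) ^ d))⁻¹ * ∑ κ ∈ S, |u κ| * momNorm κ ^ s
        ≤ (((M : ℝ) ^ d))⁻¹ * ∑ κ ∈ S, momNorm κ ^ s *
            (mix (L : ℝ) (gammaExp d ñ) N (fun j => |iteratedDeriv 0 (fun t : ℝ => baseMult Ω₀ L N j (A + t • B') κ) 0|) k +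
             mix (L : ℝ) (gammaExp d ñ) N (fun j => |iteratedDeriv 0 (fun t : ℝ => baseMult Ω₀ L N j (refOp d Ω₀ + t • (0 : Matrix (Fin d) (Fin d) ℝ)) κ) 0|) k +
             mix (L : ℝ) (gammaExp d n) N (fun j => |iteratedDeriv 0 (fun t : ℝ => baseMult Ω₀ L N j (refOp d Ω₀ + t • (0 : Matrix (Fin d) (Fin d) ℝ)) κ) 0|) k) :=
          mul_le_mul_of_nonneg_left (sum_le_sum hptwise) (by positivity)
      _ = mix (L : ℝ) (gammaExp d ñ) N (RS A B' 0) k + mix (L : ℝ) (gammaExp d ñ) N (RS (refOp d Ω₀) 0 0) k +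
            mix (L : ℝ) (gammaExp d n) N (RS (refOp d Ω₀) 0 0) k := by
          simp only [hRS, mul_add, Finset.sum_add_distrib, sum_mul_mix, Finset.mul_sum]
          unfold mix
          simp only [Finset.mul_sum]
          congr 1; congr 1
          all_goals exact sum_congr rfl fun j _ => by ring
      _ ≤ 2 * C0 / (L : ℝ) ^ ((k - 1) * (d - 2 + s)) + 2 * C0 / (L : ℝ) ^ ((k - 1) * (d - 2 + s)) +
            2 * C0 / (L : ℝ) ^ ((k - 1) * (d - 2 + s)) :=
          add_le_add (add_le_add (hmixRS ñ (hs.trans hnñ) A B' 0 C0 hC00 hA hB' hC1)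
            (hmixRS ñ (hs.trans hnñ) _ _ 0 C0 hC00 hA₀ h0unit hC2)) (hmixRS n hs _ _ 0 C0 hC00 hA₀ h0unit hC2)
      _ ≤ (2 * Cℓ + 6 * C0) / (L : ℝ) ^ ((k - 1) * (d - 2 + s)) := by
          rw [← add_div, ← add_div]
          exact div_le_div_of_nonneg_right (by nlinarith) (by positivity)
  · -- `ℓ ≥ 1`: only `𝒟̂^ñ(A + tȦ)` contributes
    have hptwise : ∀ κ ∈ S, |u κ| * momNorm κ ^ s ≤ momNorm κ ^ s *
        mix (L : ℝ) (gammaExp d ñ) N (fun j => |iteratedDeriv ℓ (fun t : ℝ => baseMult Ω₀ L N j (A + t • B') κ) 0|) k := by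
      intro κ hκ
      rw [huκ κ hκ, mul_comm, iteratedDeriv_finalMult Ω₀ n ñ K L N k A B' κ hℓpos, iteratedDeriv_mixMult hω hA hB' ñ L N k κ ℓ]
      exact mul_le_mul_of_nonneg_left (abs_mix_le_mix_abs hL' (one_le_gammaExp hd2 ñ) N _ k) (pow_nonneg (momNorm_nonneg κ) s)
    have hC1 := fun j hj1 hjN => hCℓ L N M hL hN hM A hA B' hB' j hj1 hjN
    calc (((M : ℝ) ^ d))⁻¹ * ∑ κ ∈ S, |u κ| * momNorm κ ^ s
        ≤ (((M : ℝ) ^ d))⁻¹ * ∑ κ ∈ S, momNorm κ ^ s *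
            mix (L : ℝ) (gammaExp d ñ) N (fun j => |iteratedDeriv ℓ (fun t : ℝ => baseMult Ω₀ L N j (A + t • B') κ) 0|) k :=
          mul_le_mul_of_nonneg_left (sum_le_sum hptwise) (by positivity)
      _ = mix (L : ℝ) (gammaExp d ñ) N (RS A B' ℓ) k := by
          simp only [hRS, sum_mul_mix, Finset.mul_sum]
          unfold mix
          simp only [Finset.mul_sum]
          exact sum_congr rfl fun j _ => by ring
      _ ≤ 2 * Cℓ / (L : ℝ) ^ ((k - 1) * (d - 2 + s)) := hmixRS ñ (hs.trans hnñ) A B' ℓ Cℓ hCℓ0 hA hB' hC1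
      _ ≤ (2 * Cℓ + 6 * C0) / (L : ℝ) ^ ((k - 1) * (d - 2 + s)) :=
          div_le_div_of_nonneg_right (by nlinarith) (by positivity)

end Literature.MathematicalPhysics.StatisticalMechanics.GradientFRD

end
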